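import Summits.HodgeConjecture.CorCM.Census.CentralSquaresM2Law
import Summits.HodgeConjecture.CorCM.Census.CentralSquaresChosenCover

/-!
# The square-central class, XXI: the CHOSEN COVER through the designated pair type — the `m = 2` FRAME LAW `μ(G, c) = φ₂(G, c)`

COR-CM (cell `pub-hodgecm2`), count-neutral kernel combinatorics by the binder seat b09 (gen 46; lane SQUARE-CENTRAL CLASS, part XXI), assembling parts XIII
(`exists_admissible_choice`, `isLeast_card_gfaces_generate_of_chosen_cover_closure`), I (`strict_rt`), XIX (`Y'_add_Y'_mem_of_pair_face`, `Y_add_Y_mem_of_pair_face`),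
XX (`transversal_pair`, `transversal_pair_inter`, `residual_closure_frame_two`), VI/VII (`rel_transversal_mem`, `relc_mem`) BY NAME.  Theorems only: no definition,
no `decide`, no certificate, no named fact, no `sorry`.  HONEST FRAMING: `HC_CM` is NOT proved, here or anywhere in the tree; nothing here is a period or a
headline.

THE FRAME `(T₀; T₁, Q, Q₂)` at `m = 2` (parts XVIII–XX).  The designated type `Φ = {T | a, σa}` (`D(Φ) = T ∪ {a, σa}`) is at distance `4` from all four base
changes, and EVERY single flip of it is a two-way tie (distance `3` from exactly one of `T₀, T̄₀` and one of `T₁, T̄₁`), so `Φ` carries no strict lowering triple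
and part XIIIʼs admissible choice may PRESCRIBE the cover face at the block of `Φ`:

* §1 `ddist_oflipCM_pm` (a flip changes every distance by exactly `1`), `ddist_pair_type` (all four base distances of `Φ` are `4`, `bpot Φ = 4`),
  `not_strict_pair_type` (no strict triple at `Φ`, nor — `not_strict_rt_pair_type` — at any base change of `Φ`).
* §2 **THE `m = 2` FRAME LAW `isLeast_card_gfaces_generate_two_swaps`**: `G` a `2`-group; the frame with two swaps whose place involutions differ
  everywhere; the designated type `Φ` with its face places `t, t'`; a COMPANION type `Φᶜ = {T' | s, s'}` (`T' = {u, u'} ⊆ T₀ ∩ T₁`, `{s, s'} ⊆ 𝓗` a swapped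
  pair for `Q` or for `Q₂`, `T'` a transversal for the same swap) whose face with places `u, u'` lies in every base-change stable lattice containing
  `gface Φ t t'` (in the dihedral rows: its translate by a lift of `sr` stabilising `T₀`, part XXII) ⟹ **`μ(G, c) = φ₂(G, c)`**.  Proof: prescribe
  `gface Φ t t'` (transported to the block representative) by part XIII; in the lattice of any strict cover containing it, part XIX gives one `Y'`-sum (from
  `Φ`, with `Rᶜ({a,σa}) ∈ L` by part XX + VII) and one `Y`-sum (from `Φᶜ`, with `R({s,s'}) ∈ L` by part XX + VI), part XX closes the residual lattice up to
  `2`, part XIII concludes.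

## References
* [Pohlmann1968] H. Pohlmann, Algebraic cycles on abelian varieties of complex multiplication type, Ann. of Math. 88 (1968), Thm 1.
* [Milne1999] J. S. Milne, Lefschetz motives and the Tate conjecture, Compositio Math. 117 (1999), Prop. 2.1, p. 54.
-/

namespace Summit.HodgeConjecture.CorCM.Census.CentralSquares

open Finset
open scoped symmDiff
open Summit.HodgeConjecture.CorCM.Prior.AllgGroup.RfwfAllgGroup
open Summit.HodgeConjecture.CorCM.Census.BlockParity
open Summit.HodgeConjecture.CorCM.Census.Coinvariant
open Summit.HodgeConjecture.CorCM.Census.TwistGeneration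
open Summit.HodgeConjecture.CorCM.Census.BaseBlock
open Summit.HodgeConjecture.CorCM.Census.CoverClosure

noncomputable section

variable {G : Type*} [Group G] [Fintype G] [DecidableEq G] (c : G)

/-! ## §1 The designated type is a four-way tie and carries no strict triple -/

/-- **A flip changes every distance by exactly one.** [folklore] -/
theorem ddist_oflipCM_pm (hc2 : c * c = 1) (B Ψ : CMF G c) (x : G) :
    ddist B (oflipCM c hc2 x Ψ) + 1 = ddist B Ψ ∨ ddist B (oflipCM c hc2 x Ψ) = ddist B Ψ + 1 := by
  by_cases hx : x ∈ Ψ.1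
  · have hcx : c * x ∉ Ψ.1 := (Ψ.2 x).mp hx
    rw [← oflipCM_cmul c hc2 x Ψ]
    by_cases hcxB : c * x ∈ B.1
    · exact Or.inl (ddist_oflipCM_of_mem_sdiff hc2 (mem_sdiff.mpr ⟨hcxB, hcx⟩))
    · exact Or.inr (ddist_oflipCM_of_not_mem hc2 hcx hcxB)
  · by_cases hxB : x ∈ B.1
    · exact Or.inl (ddist_oflipCM_of_mem_sdiff hc2 (mem_sdiff.mpr ⟨hxB, hx⟩))
    · exact Or.inr (ddist_oflipCM_of_not_mem hc2 hx hxB)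

section Frame

variable (hc2 : c * c = 1) (hcen : ∀ x : G, x * c = c * x) (T₀ T₁ : CMF G c)
variable (hbase : ∀ Q : G, rt c Q T₀ = T₀ ∨ rt c Q T₀ = rt c c T₀ ∨ rt c Q T₀ = T₁ ∨ rt c Q T₀ = rt c c T₁)
variable (m : ℕ) (hn : T₀.1.card = 4 * m) (hH : (T₀.1 \ T₁.1).card = 2 * m)

include hc2 hcen hbase hn hH in
/-- **The designated type is at distance `4` from all four base changes** (`m = 2`; `D(Φ) = T ∪ A`, `T ⊆ 𝓗`, `A ⊆ T₀ ∩ T₁`, `|T| = |A| = 2`), so `bpot Φ = 4`.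
[folklore] -/
theorem ddist_pair_type (hm : m = 2) (T A : Finset G) (hTH : T ⊆ T₀.1 \ T₁.1) (hTm : T.card = 2) (hA : A ⊆ T₀.1 ∩ T₁.1) (hAm : A.card = 2)
    (Φ : CMF G c) (hΦ : T₀.1 \ Φ.1 = T ∪ A) :
    bpot c T₀ Φ = 4 ∧ ∀ Q' : G, ddist (rt c Q' T₀) Φ = 4 := by
  subst hm
  have hTA : Disjoint T A := by
    rw [disjoint_iff_ne]; rintro x hx y hy rfl; exact (mem_sdiff.mp (hTH hx)).2 (mem_inter.mp (hA hy)).2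
  have hAH : Disjoint A (T₀.1 \ T₁.1) := by
    rw [disjoint_iff_ne]; rintro x hx y hy rfl; exact (mem_sdiff.mp hy).2 (mem_inter.mp (hA hx)).2
  have hD : (T₀.1 \ Φ.1).card = 4 := by rw [hΦ, card_union_of_disjoint hTA, hTm, hAm]
  have hsd : ((T₀.1 \ T₁.1) ∆ (T₀.1 \ Φ.1)).card = 4 := by rw [hΦ, card_symmDiff_union _ T A hTH hAH, hH, hTm, hAm]
  have hall : ∀ Q' : G, ddist (rt c Q' T₀) Φ = 4 := by
    intro Q'
    rcases hbase Q' with h | h | h | h <;> rw [h]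
    · rw [ddist_base_eq, hD]
    · rw [ddist_compl_base_eq c T₀ hc2 hcen, hD, hn]
    · rw [ddist_eq_card_symmDiff c T₀ hc2, hsd]
    · rw [ddist_compl_eq c T₀ hc2 hcen, hsd, hn]
  refine ⟨?_, hall⟩
  obtain ⟨Q', hQ'⟩ := exists_bpot_eq c T₀ Φ
  rw [hQ', hall]

include hc2 hcen hbase hn hH in
/-- **The designated type carries NO strict lowering triple** (`m = 2`): after any single flip the nearest base change is attained twice. [folklore] -/
theorem not_strict_pair_type (hm : m = 2) (T A : Finset G) (hTH : T ⊆ T₀.1 \ T₁.1) (hTm : T.card = 2) (hA : A ⊆ T₀.1 ∩ T₁.1) (hAm : A.card = 2)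
    (Φ : CMF G c) (hΦ : T₀.1 \ Φ.1 = T ∪ A) {Q : G} (hQ : rt c Q T₀ = T₁) :
    ¬ ∃ Q₁ x x' : G, bpot c T₀ Φ = ddist (rt c Q₁ T₀) Φ ∧ x ∈ (rt c Q₁ T₀).1 \ Φ.1 ∧ x' ∈ (rt c Q₁ T₀).1 \ Φ.1 ∧ x ≠ x' ∧
      (∀ Q' : G, ddist (rt c Q' T₀) (oflipCM c hc2 x Φ) = bpot c T₀ (oflipCM c hc2 x Φ) → rt c Q' T₀ = rt c Q₁ T₀) ∧
      (∀ Q' : G, ddist (rt c Q' T₀) (oflipCM c hc2 x' Φ) = bpot c T₀ (oflipCM c hc2 x' Φ) → rt c Q' T₀ = rt c Q₁ T₀) ∧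
      (∀ Q' : G, ddist (rt c Q' T₀) (oflipCM c hc2 x (oflipCM c hc2 x' Φ)) = bpot c T₀ (oflipCM c hc2 x (oflipCM c hc2 x' Φ)) →
        rt c Q' T₀ = rt c Q₁ T₀) := by
  obtain ⟨-, hall⟩ := ddist_pair_type c hc2 hcen T₀ T₁ hbase m hn hH hm T A hTH hTm hA hAm Φ hΦ
  subst hm
  rintro ⟨Q₁, x, x', -, hx, -, -, hu1, -, -⟩
  -- the flipped type `Y` is at distance `3` from `T₀·Q₁⁻¹`, which is then its only nearest base change, so `bpot Y = 3`
  have h3 : ddist (rt c Q₁ T₀) (oflipCM c hc2 x Φ) = 3 := by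
    have h := ddist_oflipCM_of_mem_sdiff hc2 hx; rw [hall] at h; omega
  have hb3 : bpot c T₀ (oflipCM c hc2 x Φ) = 3 := by
    obtain ⟨Q', hQ'⟩ := exists_bpot_eq c T₀ (oflipCM c hc2 x Φ)
    rw [hQ', hu1 Q' hQ'.symm, h3]
  have key : ∀ Q' : G, ddist (rt c Q' T₀) (oflipCM c hc2 x Φ) = 3 → rt c Q' T₀ = rt c Q₁ T₀ := fun Q' h => hu1 Q' (by rw [h, hb3])
  -- every base distance of `Y` is `3` or `5`, and complementary base changes have distances summing to `8`
  have hpm : ∀ Q' : G, ddist (rt c Q' T₀) (oflipCM c hc2 x Φ) = 3 ∨ ddist (rt c Q' T₀) (oflipCM c hc2 x Φ) = 5 := by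
    intro Q'
    rcases ddist_oflipCM_pm c hc2 (rt c Q' T₀) Φ x with h | h <;> rw [hall] at h <;> omega
  have hDle : (T₀.1 \ (oflipCM c hc2 x Φ).1).card ≤ T₀.1.card := card_le_card sdiff_subset
  have hSle : ((T₀.1 \ T₁.1) ∆ (T₀.1 \ (oflipCM c hc2 x Φ).1)).card ≤ T₀.1.card := by
    apply card_le_card; intro y hy; rw [mem_symmDiff] at hy
    rcases hy with ⟨h, -⟩ | ⟨h, -⟩
    · exact (mem_sdiff.mp h).1
    · exact (mem_sdiff.mp h).1
  have h0 : ddist (rt c 1 T₀) (oflipCM c hc2 x Φ) = 3 ∨ ddist (rt c c T₀) (oflipCM c hc2 x Φ) = 3 := by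
    have e0 := ddist_base_eq c T₀ (oflipCM c hc2 x Φ)
    have e0' := ddist_compl_base_eq c T₀ hc2 hcen (oflipCM c hc2 x Φ)
    rw [rt_one]
    rcases hpm 1 with h | h
    · left; rwa [rt_one] at h
    · right; rw [rt_one] at h; omega
  have h1 : ddist (rt c Q T₀) (oflipCM c hc2 x Φ) = 3 ∨ ddist (rt c (c * Q) T₀) (oflipCM c hc2 x Φ) = 3 := by
    have e1 := ddist_eq_card_symmDiff c T₀ hc2 T₁ (oflipCM c hc2 x Φ)
    have e1' := ddist_compl_eq c T₀ hc2 hcen T₁ (oflipCM c hc2 x Φ)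
    rw [rt_mul, hQ]
    rcases hpm Q with h | h
    · left; rw [hQ] at h; exact h
    · right; rw [hQ] at h; omega
  -- two distinct nearest base changes
  have hne01 : T₀ ≠ T₁ := by
    intro h; rw [← h, Finset.sdiff_self, Finset.card_empty] at hH; omega
  have hHc : (T₀.1 ∩ T₁.1).Nonempty := by
    apply card_pos.mp; have h0 := card_sdiff_add_card_inter T₀.1 T₁.1; omega
  have hne01' : T₀ ≠ rt c c T₁ := by
    intro h; obtain ⟨y, hy⟩ := hHc
    have hy' : y ∈ (rt c c T₁).1 := h ▸ (mem_inter.mp hy).1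
    rw [rt_self_val c hcen, mem_sdiff] at hy'
    exact hy'.2 (mem_inter.mp hy).2
  have hne0'1 : rt c c T₀ ≠ T₁ := by
    intro h; obtain ⟨y, hy⟩ := hHc
    have hy' : y ∈ (rt c c T₀).1 := h.symm ▸ (mem_inter.mp hy).2
    rw [rt_self_val c hcen, mem_sdiff] at hy'
    exact hy'.2 (mem_inter.mp hy).1
  have hne0'1' : rt c c T₀ ≠ rt c c T₁ := fun h => hne01 ((rt_bijective c c).1 h)
  rcases h0 with h0 | h0 <;> rcases h1 with h1 | h1
  · exact hne01 (by rw [← rt_one c T₀, key 1 h0, ← hQ, key Q h1])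
  · exact hne01' (by rw [← rt_one c T₀, key 1 h0, ← hQ, ← rt_mul, key (c * Q) h1])
  · exact hne0'1 (by rw [key c h0, ← hQ, key Q h1])
  · exact hne0'1' (by rw [key c h0, ← hQ, ← rt_mul, key (c * Q) h1])

include hc2 hcen hbase hn hH in
/-- **No base change of the designated type carries a strict lowering triple** (transport by part Iʼs `strict_rt`). [folklore] -/
theorem not_strict_rt_pair_type (hm : m = 2) (T A : Finset G) (hTH : T ⊆ T₀.1 \ T₁.1) (hTm : T.card = 2) (hA : A ⊆ T₀.1 ∩ T₁.1)
    (hAm : A.card = 2) (Φ : CMF G c) (hΦ : T₀.1 \ Φ.1 = T ∪ A) {Q : G} (hQ : rt c Q T₀ = T₁) (g : G) :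
    ¬ ∃ Q₁ x x' : G, bpot c T₀ (rt c g Φ) = ddist (rt c Q₁ T₀) (rt c g Φ) ∧ x ∈ (rt c Q₁ T₀).1 \ (rt c g Φ).1 ∧
      x' ∈ (rt c Q₁ T₀).1 \ (rt c g Φ).1 ∧ x ≠ x' ∧
      (∀ Q' : G, ddist (rt c Q' T₀) (oflipCM c hc2 x (rt c g Φ)) = bpot c T₀ (oflipCM c hc2 x (rt c g Φ)) → rt c Q' T₀ = rt c Q₁ T₀) ∧
      (∀ Q' : G, ddist (rt c Q' T₀) (oflipCM c hc2 x' (rt c g Φ)) = bpot c T₀ (oflipCM c hc2 x' (rt c g Φ)) → rt c Q' T₀ = rt c Q₁ T₀) ∧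
      (∀ Q' : G, ddist (rt c Q' T₀) (oflipCM c hc2 x (oflipCM c hc2 x' (rt c g Φ))) = bpot c T₀ (oflipCM c hc2 x (oflipCM c hc2 x' (rt c g Φ))) →
        rt c Q' T₀ = rt c Q₁ T₀) := by
  rintro ⟨Q₁, x, x', h1, hx, hx', hxx', hu1, hu2, hu3⟩
  obtain ⟨k1, kx, kx', kxx', ku1, ku2, ku3⟩ := strict_rt c T₀ hc2 g⁻¹ h1 hx hx' hxx' hu1 hu2 hu3
  rw [rt_inv_rt] at k1 kx kx' ku1 ku2 ku3
  exact not_strict_pair_type c hc2 hcen T₀ T₁ hbase m hn hH hm T A hTH hTm hA hAm Φ hΦ hQ ⟨_, _, _, k1, kx, kx', kxx', ku1, ku2, ku3⟩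

/-! ## §2 The `m = 2` frame law -/

include hc2 hcen hbase hn hH in
/-- **THE `m = 2` FRAME LAW.**  `G` a finite `2`-group, `c` a central involution `≠ 1`; the four-type frame `(T₀; T₁)` with `|T₀| = 8`, `|𝓗| = 4` and TWO
swaps `Q`, `Q₂` (`T₀·Q⁻¹ = T₀·Q₂⁻¹ = T₁`, `Q² = Q₂² = 1`, place involutions preserving `𝓗` and differing at every place); a `σ`-transversal `T = {t, t'} ⊆ 𝓗`,
`a ∈ T₀ ∩ T₁` with `σ`-image `a'`, the designated type `Φ` (`D(Φ) = T ∪ {a, a'}`); and a companion type `Φᶜ` (`D(Φᶜ) = T' ∪ {s, s'}`, `T' = {u, u'} ⊆ T₀ ∩ T₁`,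
`s ∈ 𝓗`, with `T'` a transversal and `s'` the image of `s` for ONE of the two swaps) such that every base-change stable lattice containing the face of `Φ`
with places `t, t'` contains the face of `Φᶜ` with places `u, u'`.  Then **`μ(G, c) = φ₂(G, c)`**: the least number of faces whose base changes together with
the pairs generate the Hodge lattice is the coinvariant fibre. [folklore] -/
theorem isLeast_card_gfaces_generate_two_swaps (hG : IsPGroup 2 G) (hc1 : c ≠ 1) (hm : m = 2)
    (Q : G) (hQ : rt c Q T₀ = T₁) (hQQ : Q * Q = 1)
    (hσH : ∀ t ∈ T₀.1, ∀ t' ∈ T₀.1, (t' = t * Q ∨ t' = c * (t * Q)) → (t ∈ T₀.1 \ T₁.1 ↔ t' ∈ T₀.1 \ T₁.1))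
    (Q₂ : G) (hQ₂ : rt c Q₂ T₀ = T₁) (hQQ₂ : Q₂ * Q₂ = 1)
    (hσH₂ : ∀ t ∈ T₀.1, ∀ t' ∈ T₀.1, (t' = t * Q₂ ∨ t' = c * (t * Q₂)) → (t ∈ T₀.1 \ T₁.1 ↔ t' ∈ T₀.1 \ T₁.1))
    (hne : ∀ t ∈ T₀.1, ∀ t' ∈ T₀.1, ∀ t'' ∈ T₀.1, (t' = t * Q ∨ t' = c * (t * Q)) → (t'' = t * Q₂ ∨ t'' = c * (t * Q₂)) → t' ≠ t'')
    (T : Finset G) (hTH : T ⊆ T₀.1 \ T₁.1)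
    (hT : ∀ t ∈ T₀.1 \ T₁.1, ∀ t' ∈ T₀.1, (t' = t * Q ∨ t' = c * (t * Q)) → (t ∈ T ↔ t' ∉ T))
    {t t' : G} (hTe : T = {t, t'}) (htt' : t ≠ t')
    {a a' : G} (ha : a ∈ T₀.1 ∩ T₁.1) (ha' : a' ∈ T₀.1) (haa' : a' = a * Q ∨ a' = c * (a * Q))
    (Φ : CMF G c) (hΦ : T₀.1 \ Φ.1 = T ∪ {a, a'})
    (T' : Finset G) (hTH' : T' ⊆ T₀.1 ∩ T₁.1) {u u' : G} (hTe' : T' = {u, u'}) (huu' : u ≠ u')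
    {s s' : G} (hs : s ∈ T₀.1 \ T₁.1) (hs' : s' ∈ T₀.1)
    (hcase : ((∀ v ∈ T₀.1 ∩ T₁.1, ∀ v' ∈ T₀.1, (v' = v * Q ∨ v' = c * (v * Q)) → (v ∈ T' ↔ v' ∉ T')) ∧ (s' = s * Q ∨ s' = c * (s * Q))) ∨
      ((∀ v ∈ T₀.1 ∩ T₁.1, ∀ v' ∈ T₀.1, (v' = v * Q₂ ∨ v' = c * (v * Q₂)) → (v ∈ T' ↔ v' ∉ T')) ∧ (s' = s * Q₂ ∨ s' = c * (s * Q₂))))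
    (Φc : CMF G c) (hΦc : T₀.1 \ Φc.1 = T' ∪ {s, s'})
    (hcomp : ∀ L : Submodule ℤ (CMF G c →₀ ℤ), (∀ (Q' : G) (y : CMF G c →₀ ℤ), y ∈ L → Finsupp.mapDomain (rt c Q') y ∈ L) →
      gface c hc2 Φ t t' ∈ L → gface c hc2 Φc u u' ∈ L) :
    IsLeast {n : ℕ | ∃ S : Finset (CMF G c →₀ ℤ), (↑S ⊆ gfaceSet G c hc2) ∧ S.card = n ∧
      hodgeSpan c hc2 ≤ Submodule.span ℤ (pairSet c) ⊔ Submodule.span ℤ (translates c S)} (fibreTwo c hc2) := by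
  have hm2 : 2 ≤ m := by omega
  have hHc : (T₀.1 ∩ T₁.1).Nonempty := ⟨a, ha⟩
  have hne' : ∀ t ∈ T₀.1, ∀ t' ∈ T₀.1, ∀ t'' ∈ T₀.1, (t' = t * Q₂ ∨ t' = c * (t * Q₂)) → (t'' = t * Q ∨ t'' = c * (t * Q)) → t' ≠ t'' :=
    fun t ht t' ht' t'' ht'' h1 h2 => (hne t ht t'' ht'' t' ht' h2 h1).symm
  have ha0 : a ∈ T₀.1 := (mem_inter.mp ha).1
  have ha1 : a ∈ T₁.1 := (mem_inter.mp ha).2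
  have ha'1 : a' ∈ T₁.1 := by
    by_contra h
    exact (mem_sdiff.mp ((hσH a ha0 a' ha' haa').mpr (mem_sdiff.mpr ⟨ha', h⟩))).2 ha1
  have ha'i : a' ∈ T₀.1 ∩ T₁.1 := mem_inter.mpr ⟨ha', ha'1⟩
  have haa'ne : a ≠ a' := ne_rep c hc2 T₀ T₁ m hH Q hQ hcen (by omega) hHc haa'
  have hAsub : ({a, a'} : Finset G) ⊆ T₀.1 ∩ T₁.1 := by
    intro x hx; rw [mem_insert, mem_singleton] at hx; rcases hx with rfl | rfl
    · exact ha
    · exact ha'i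
  have hTm : T.card = 2 := by rw [hTe, card_pair htt']
  have hTm' : T.card = m := by rw [hTm, hm]
  have htT : t ∈ T := by rw [hTe]; exact mem_insert_self _ _
  have ht'T : t' ∈ T := by rw [hTe]; exact mem_insert_of_mem (mem_singleton_self _)
  have htΦ : t ∈ T₀.1 \ Φ.1 := by rw [hΦ]; exact mem_union_left _ htT
  have ht'Φ : t' ∈ T₀.1 \ Φ.1 := by rw [hΦ]; exact mem_union_left _ ht'T
  -- a `σ`-transversal of `T₀ ∩ T₁`: the `σ₂`-pair through `a`
  obtain ⟨a'', ha''0, haa''⟩ := exists_rep c T₀.2 (a * Q₂)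
  obtain ⟨hA''sub, hA''card, hA''tr⟩ :=
    transversal_pair_inter c hc2 hcen T₀ T₁ m hn hH Q₂ hQ₂ hQQ₂ hσH₂ Q hQ hσH hne' hm ha ha''0 haa''
  -- the block of the designated type and its representative
  obtain ⟨hb4, hall⟩ := ddist_pair_type c hc2 hcen T₀ T₁ hbase m hn hH hm T {a, a'} hTH hTm hAsub (card_pair haa'ne) Φ hΦ
  obtain ⟨g, hg⟩ : ∃ g : G, rt c g Φ = (blk c Φ).out := exists_rt_eq_of_blk_eq c (blk_out c (blk c Φ)).symm
  have hlow₀ : bpot c T₀ (blk c Φ).out = ddist (rt c g T₀) (blk c Φ).out ∧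
      t * g⁻¹ ∈ (rt c g T₀).1 \ ((blk c Φ).out).1 ∧ t' * g⁻¹ ∈ (rt c g T₀).1 \ ((blk c Φ).out).1 ∧ t * g⁻¹ ≠ t' * g⁻¹ := by
    rw [← hg, bpot_rt, ddist_rt, hb4, mem_sdiff_rt_iff, mem_sdiff_rt_iff, inv_mul_cancel_right, inv_mul_cancel_right]
    refine ⟨?_, htΦ, ht'Φ, fun h => htt' (mul_right_cancel h)⟩
    have h := hall 1; rw [rt_one] at h; exact h.symm
  have h₀ns := not_strict_rt_pair_type c hc2 hcen T₀ T₁ hbase m hn hH hm T {a, a'} hTH hTm hAsub (card_pair haa'ne) Φ hΦ hQ g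
  rw [hg] at h₀ns
  obtain ⟨τ, hτ₀, hτlow, hτstr⟩ := exists_admissible_choice c T₀ hc2 (blk c Φ) (g, t * g⁻¹, t' * g⁻¹) hlow₀ h₀ns
  refine isLeast_card_gfaces_generate_of_chosen_cover_closure c T₀ hG hc2 hc1 hcen 1 τ hτlow hτstr fun S hS hmem hlow => ?_
  -- the lattice of a strict cover containing the chosen face
  have hP : ∀ Ψ : CMF G c, pair c Ψ ∈ Submodule.span ℤ (pairSet c) ⊔ Submodule.span ℤ (translates c S) :=
    fun Ψ => Submodule.mem_sup_left (Submodule.subset_span (pair_mem_pairSet c Ψ))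
  have hLrt : ∀ (Q' : G) (y : CMF G c →₀ ℤ), y ∈ Submodule.span ℤ (pairSet c) ⊔ Submodule.span ℤ (translates c S) →
      Finsupp.mapDomain (rt c Q') y ∈ Submodule.span ℤ (pairSet c) ⊔ Submodule.span ℤ (translates c S) :=
    fun Q' y hy => mapDomain_rt_mem_psp c hcen Q' S hy
  have hcover : ∀ Ψ : CMF G c, 2 ≤ bpot c T₀ Ψ → ∃ Q₃ x x' : G, bpot c T₀ Ψ = ddist (rt c Q₃ T₀) Ψ ∧
      x ∈ (rt c Q₃ T₀).1 \ Ψ.1 ∧ x' ∈ (rt c Q₃ T₀).1 \ Ψ.1 ∧ x ≠ x' ∧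
      gface c hc2 Ψ x x' ∈ Submodule.span ℤ (pairSet c) ⊔ Submodule.span ℤ (translates c S) ∧
      ((∃ Q₁ y y' : G, bpot c T₀ Ψ = ddist (rt c Q₁ T₀) Ψ ∧ y ∈ (rt c Q₁ T₀).1 \ Ψ.1 ∧ y' ∈ (rt c Q₁ T₀).1 \ Ψ.1 ∧ y ≠ y' ∧
          (∀ Q' : G, ddist (rt c Q' T₀) (oflipCM c hc2 y Ψ) = bpot c T₀ (oflipCM c hc2 y Ψ) → rt c Q' T₀ = rt c Q₁ T₀) ∧
          (∀ Q' : G, ddist (rt c Q' T₀) (oflipCM c hc2 y' Ψ) = bpot c T₀ (oflipCM c hc2 y' Ψ) → rt c Q' T₀ = rt c Q₁ T₀) ∧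
          (∀ Q' : G, ddist (rt c Q' T₀) (oflipCM c hc2 y (oflipCM c hc2 y' Ψ)) = bpot c T₀ (oflipCM c hc2 y (oflipCM c hc2 y' Ψ)) →
            rt c Q' T₀ = rt c Q₁ T₀)) →
        (∀ Q' : G, ddist (rt c Q' T₀) (oflipCM c hc2 x Ψ) = bpot c T₀ (oflipCM c hc2 x Ψ) → rt c Q' T₀ = rt c Q₃ T₀) ∧
        (∀ Q' : G, ddist (rt c Q' T₀) (oflipCM c hc2 x' Ψ) = bpot c T₀ (oflipCM c hc2 x' Ψ) → rt c Q' T₀ = rt c Q₃ T₀) ∧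
        (∀ Q' : G, ddist (rt c Q' T₀) (oflipCM c hc2 x (oflipCM c hc2 x' Ψ)) = bpot c T₀ (oflipCM c hc2 x (oflipCM c hc2 x' Ψ)) →
          rt c Q' T₀ = rt c Q₃ T₀)) := by
    intro Ψ h2
    obtain ⟨Q₃, x, x', hQ₃, hx, hx', hxx', hxmem, hstr⟩ := hlow Ψ h2
    exact ⟨Q₃, x, x', hQ₃, hx, hx', hxx', Submodule.mem_sup_right hxmem, hstr⟩
  -- the designated face and its companion lie in the lattice
  have hF : gface c hc2 Φ t t' ∈ Submodule.span ℤ (pairSet c) ⊔ Submodule.span ℤ (translates c S) := by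
    have h2 : 2 ≤ bpot c T₀ (blk c Φ).out := by rw [bpot_out, hb4]; omega
    have hS' := hmem (blk c Φ) h2
    rw [hτ₀, ← hg] at hS'
    have hS'' : gface c hc2 (rt c g Φ) (t * g⁻¹) (t' * g⁻¹) ∈ translates c S :=
      ⟨1, _, hS', by rw [show rt c (1 : G) = id from funext (rt_one c), Finsupp.mapDomain_id]⟩
    have h := hLrt g⁻¹ _ (Submodule.mem_sup_right (Submodule.subset_span hS''))
    rwa [mapDomain_rt_gface, rt_inv_rt, inv_inv, inv_mul_cancel_right, inv_mul_cancel_right] at h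
  have hFc := hcomp _ hLrt hF
  -- the `Y'`-sum from the designated face (`Rᶜ({a, a'}) ∈ L` by the second swap)
  obtain ⟨hAsub', hAcard, hAtr⟩ := transversal_pair_inter c hc2 hcen T₀ T₁ m hn hH Q hQ hQQ hσH Q₂ hQ₂ hσH₂ hne hm ha ha' haa'
  have hRc := relc_mem c hc2 hcen T₀ T₁ hbase m hn hH Q₂ hQ₂ hQQ₂ hσH₂ _ hLrt hcover hP hm2 {a, a'} hAsub' hAcard hAtr
  have hY' := Y'_add_Y'_mem_of_pair_face c hc2 hcen T₀ T₁ hbase m hn hH Q hQ hQQ hσH _ hLrt hP hcover hm T hTH hTm' hT hTe htt' ha ha' haa'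
    Φ hΦ hF hRc
  -- the `Y`-sum from the companion face (`R({s, s'}) ∈ L` by the other swap)
  have hs0 : s ∈ T₀.1 := (mem_sdiff.mp hs).1
  have hTcard' : T'.card = m := by rw [hTe', card_pair huu', hm]
  have hY : ∃ s₀ ∈ T₀.1 \ T₁.1, ∃ s₀' ∈ T₀.1 \ T₁.1,
      ((Finsupp.single (oflipCM c hc2 s₀ T₀) (1 : ℤ) - Finsupp.single T₀ 1) + (Finsupp.single (oflipCM c hc2 s₀ T₁) (1 : ℤ) - Finsupp.single T₁ 1)) +
        ((Finsupp.single (oflipCM c hc2 s₀' T₀) (1 : ℤ) - Finsupp.single T₀ 1) + (Finsupp.single (oflipCM c hc2 s₀' T₁) (1 : ℤ) - Finsupp.single T₁ 1))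
        ∈ Submodule.span ℤ (pairSet c) ⊔ Submodule.span ℤ (translates c S) := by
    rcases hcase with ⟨hT'tr, hss'⟩ | ⟨hT'tr, hss'⟩
    · obtain ⟨hSsub, hScard, hStr⟩ := transversal_pair c hc2 hcen T₀ T₁ m hn hH Q hQ hQQ hσH Q₂ hQ₂ hσH₂ hne hm hs hs' hss'
      have hR := rel_transversal_mem c hc2 hcen T₀ T₁ hbase m hn hH Q₂ hQ₂ hQQ₂ hσH₂ _ hLrt hcover hm2 {s, s'} hSsub hScard hStr
      exact ⟨s, hs, s', (hσH s hs0 s' hs' hss').mp hs, Y_add_Y_mem_of_pair_face c hc2 hcen T₀ T₁ hbase m hn hH Q hQ hQQ hσH _ hLrt hP hcover hm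
        T' hTH' hTcard' hT'tr hTe' huu' hs hs' hss' Φc hΦc hFc hR⟩
    · obtain ⟨hSsub, hScard, hStr⟩ := transversal_pair c hc2 hcen T₀ T₁ m hn hH Q₂ hQ₂ hQQ₂ hσH₂ Q hQ hσH hne' hm hs hs' hss'
      have hR := rel_transversal_mem c hc2 hcen T₀ T₁ hbase m hn hH Q hQ hQQ hσH _ hLrt hcover hm2 {s, s'} hSsub hScard hStr
      exact ⟨s, hs, s', (hσH₂ s hs0 s' hs' hss').mp hs, Y_add_Y_mem_of_pair_face c hc2 hcen T₀ T₁ hbase m hn hH Q₂ hQ₂ hQQ₂ hσH₂ _ hLrt hP hcover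
        hm T' hTH' hTcard' hT'tr hTe' huu' hs hs' hss' Φc hΦc hFc hR⟩
  exact residual_closure_frame_two c hc2 hcen T₀ T₁ hbase m hn hH Q hQ hQQ hσH Q₂ hQ₂ hQQ₂ hσH₂ hne _ hLrt hP hcover hc1 hm T hTH hTm' hT
    {a, a''} hA''sub hA''card hA''tr hY ⟨a, ha, a', ha'i, hY'⟩

end Frame

end

end Summit.HodgeConjecture.CorCM.Census.CentralSquares
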